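import Literature.NumberTheory.LFunctions.MoebiusCharacterSumData
import Literature.NumberTheory.LFunctions.SiegelWalfiszMoebius
import Literature.NumberTheory.LFunctions.SiegelExceptionalZeroBound
import HarnessLib

/-!
# `M(x, χ) ≪_A x exp(−c₁√log x)` for `q ≤ (log x)^A` (Montgomery–Vaughan §11.3 Exercise 8), proved

Topic `Literature/NumberTheory/LFunctions`. Everything in this file is PROVED (theorems only); it
discharges the named fact `Literature.NumberTheory.LFunctions.MoebiusCharacterSumBound`
(`SiegelWalfiszMoebius.lean`; MV §11.3 Exercise 8, p. 383):

> there is an absolute `c₁ > 0` such that for every `A > 0` there is `C` with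
> `‖∑_{n ≤ x} μ(n)χ(n)‖ ≤ C x exp(−c₁√log x)` for all `x ≥ 2`, `1 ≤ q ≤ (log x)^A`, `χ` mod `q`.

## The argument (MV Exercises 7–8 with Theorem 11.16 and Corollary 11.18)

`MoebiusCharacterSumData.lean` verifies the hypotheses `ExcPsiData` of the tree's Landau engine
with an exceptional zero (`ExceptionalZeroPsi.lean`) for the non-negative sequences
`Λ'(n) = 1 + λ Re(w χ(n)) μ(n)` (`|w| ≤ 1`, `λ = 1/(K log 4q + 1)`), with ABSOLUTE region constant
`c` and bound `C₀ q²`, level `L = log q`, and the exceptional pole `−α/(s − β)` present only when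
`χ ≠ χ₀` is quadratic with a real zero `β` close to `1`. `ExcPsiData.exists_psi_bound` then gives,
for `x ≥ 64` and `log q ≤ √log x`,
`|⌊x⌋ + λ Re(w M(x, χ)) − x + α x^β/β| ≤ A(c)(C₀q² + 1) x e^{−(c/80)√log x}`
(`MoebiusTwist.psi_coeff_eq`); Siegel's theorem (MV Corollary 11.15,
`Siegel.exists_one_sub_realZero_ge` with `ε = 1/(4A+4)`) bounds the exceptional term
`x^β ≤ K_A x e^{−(c/80)√log x}` for `q ≤ (log x)^A` (`MoebiusTwist.exists_rpow_excZero_le`, MV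
proof of Cor. 11.18); `w = 1` and `w = −i` give `Re M` and `Im M`
(`MoebiusTwist.exists_core_bound`). Finally, for `q ≤ (log x)^A` the condition `log q ≤ √log x`
holds once `log x ≥ (4A)⁴`, smaller `x` being trivial (`|M(x, χ)| ≤ x`), and the factors
`q² ≤ (log x)^{2A}`, `1/λ ≪ log 4q ≪ √log x` are absorbed by passing from `c/80` to `c₁ = c/160`.

## References

* H. L. Montgomery, R. C. Vaughan, *Multiplicative Number Theory I. Classical Theory*, CUP 2007,
  §11.3: Exercises 7–8 (p. 383), Theorem 11.16, Corollaries 11.15 and 11.18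
  (`MontgomeryVaughan2007`).
-/

noncomputable section

open Complex Filter Topology Metric Set Finset
open scoped ArithmeticFunction.Moebius ComplexConjugate

namespace Literature.NumberTheory.LFunctions

namespace MoebiusTwist

open ClassicalPsiData

/-! ## From `ExcPsiData` to the twisted Möbius sums -/

/-- The summatory function of `1 + λ Re(w χ(n)) μ(n)`:
`∑_{n ≤ x} (1 + λ Re(wχ(n))μ(n)) = ⌊x⌋ + λ Re(w · ∑_{n ≤ x} χ(n)μ(n))`. [folklore] -/
theorem psi_coeff_eq {q : ℕ} (χ : DirichletCharacter ℂ q) (w : ℂ) (lam x : ℝ) :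
    psi (fun n : ℕ ↦ 1 + lam * (w * χ (n : ZMod q) * (μ n : ℂ)).re) x =
      (⌊x⌋₊ : ℝ) + lam * (w * ∑ n ∈ Finset.Ioc 0 ⌊x⌋₊, χ (n : ZMod q) * (μ n : ℂ)).re := by
  rw [psi, Finset.sum_add_distrib, Finset.sum_const, Nat.card_Ioc, nsmul_eq_mul, mul_one,
    Nat.sub_zero, Finset.mul_sum, Complex.re_sum, Finset.mul_sum]
  congr 1
  exact Finset.sum_congr rfl fun n _ ↦ by ring_nf

/-- **Siegel's theorem kills the exceptional term** (Montgomery–Vaughan Corollary 11.18, proof):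
given `A > 0` there are `K_A ≥ 1` and the absolute `c' > 0` below such that for every
quadratic `χ ≠ χ₀` mod `q`, every real zero `β` of `L(s, χ)`, every `x ≥ 64` with
`q ≤ (log x)^A`: `x^β ≤ K_A x exp(−c'√log x)`. ("`x^{β₁} = x exp(−(1 − β₁)log x) ≤
x exp(−C(ε)q^{−ε} log x) ≤ x exp(−C(ε)(log x)^{1−Aε})`", with `ε = 1/(4A + 4)`.)
[cite: MontgomeryVaughan2007, Corollary 11.18 (proof)] -/
theorem exists_rpow_excZero_le {c' : ℝ} (hc' : 0 < c') {A : ℝ} (hA : 0 < A) :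
    ∃ KA : ℝ, 1 ≤ KA ∧ ∀ (q : ℕ) [NeZero q] (χ : DirichletCharacter ℂ q), χ ^ 2 = 1 → χ ≠ 1 →
      ∀ β : ℝ, χ.LFunction β = 0 → ∀ x : ℝ, 64 ≤ x → (q : ℝ) ≤ Real.log x ^ A →
        x ^ β ≤ KA * x * Real.exp (-(c' * Real.sqrt (Real.log x))) := by
  set ε : ℝ := 1 / (4 * A + 4) with hε
  have hε0 : 0 < ε := by positivity
  have hAε : A * ε ≤ 1 / 4 := by
    rw [hε, mul_one_div, div_le_iff₀ (by positivity)]; linarith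
  obtain ⟨Cε, hCε, hS⟩ := Siegel.exists_one_sub_realZero_ge hε0
  set v₀ : ℝ := c' / Cε with hv₀
  refine ⟨Real.exp (c' * v₀ ^ 2), Real.one_le_exp (by positivity), fun q _ χ hχ2 hχ β hβ x hx hqx ↦ ?_⟩
  have hx0 : 0 < x := by linarith
  have hx1 : 1 < x := by linarith
  set L : ℝ := Real.log x with hL
  have hL4 : 4 ≤ L := by
    rw [hL, ← Real.log_exp 4]
    refine Real.log_le_log (Real.exp_pos 4) ?_
    have h1 := Real.exp_one_lt_d9
    have h4 : Real.exp 4 = Real.exp 1 ^ 4 := by rw [← Real.exp_nat_mul]; norm_num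
    rw [h4]
    calc Real.exp 1 ^ 4 ≤ (2.7182818286 : ℝ) ^ 4 :=
          pow_le_pow_left₀ (Real.exp_pos 1).le h1.le 4
      _ ≤ 64 := by norm_num
      _ ≤ x := hx
  have hL1 : 1 ≤ L := by linarith
  have hL0 : 0 < L := by linarith
  -- `v = L^{1/4}`: `v² = √L`, `v⁴ = L`
  set v : ℝ := Real.sqrt (Real.sqrt L) with hv
  have hv0 : 0 ≤ v := Real.sqrt_nonneg _
  have hv2 : v ^ 2 = Real.sqrt L := Real.sq_sqrt (Real.sqrt_nonneg L)
  have hv4 : v ^ 4 = L := by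
    rw [show (4 : ℕ) = 2 * 2 by norm_num, pow_mul, hv2, Real.sq_sqrt hL0.le]
  have hv1 : 1 ≤ v := by rw [hv]; exact Real.one_le_sqrt.2 (Real.one_le_sqrt.2 hL1)
  have hvpos : 0 < v := by linarith
  have hvrpow : v = L ^ (1 / 4 : ℝ) := by
    rw [hv, Real.sqrt_eq_rpow, Real.sqrt_eq_rpow, ← Real.rpow_mul hL0.le]; norm_num
  -- Siegel: `Cε q^{-ε} ≤ 1 − β`, and `q^ε ≤ L^{Aε} ≤ L^{1/4} = v`
  have hq1 : (1 : ℝ) ≤ q := by exact_mod_cast NeZero.one_le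
  have hq0 : (0 : ℝ) < q := by linarith
  have hSiegel := hS q χ hχ2 hχ β hβ
  have hqε : (q : ℝ) ^ ε ≤ v := by
    calc (q : ℝ) ^ ε ≤ (L ^ A) ^ ε := Real.rpow_le_rpow hq0.le hqx hε0.le
      _ = L ^ (A * ε) := by rw [← Real.rpow_mul hL0.le]
      _ ≤ L ^ (1 / 4 : ℝ) := Real.rpow_le_rpow_of_exponent_le hL1 hAε
      _ = v := hvrpow.symm
  have hgap : Cε * v ^ 3 ≤ (1 - β) * L := by
    have h1 : Cε / v ≤ Cε * (q : ℝ) ^ (-ε) := by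
      rw [Real.rpow_neg hq0.le, ← div_eq_mul_inv]
      exact div_le_div_of_nonneg_left hCε.le (Real.rpow_pos_of_pos hq0 ε) hqε
    have h2 : Cε / v ≤ 1 - β := h1.trans hSiegel
    calc Cε * v ^ 3 = Cε / v * v ^ 4 := by field_simp
      _ ≤ (1 - β) * v ^ 4 := mul_le_mul_of_nonneg_right h2 (by positivity)
      _ = (1 - β) * L := by rw [hv4]
  -- `x^β = x exp(−(1−β)L) ≤ x exp(−Cε v³)`
  have hxβ : x ^ β = x * Real.exp (-((1 - β) * L)) := by
    rw [Real.rpow_def_of_pos hx0, ← hL]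
    calc Real.exp (L * β) = Real.exp (L + -((1 - β) * L)) := by ring_nf
      _ = x * Real.exp (-((1 - β) * L)) := by rw [Real.exp_add, hL, Real.exp_log hx0]
  rw [hxβ]
  have hstep : Real.exp (-((1 - β) * L)) ≤ Real.exp (c' * v₀ ^ 2) * Real.exp (-(c' * Real.sqrt L)) := by
    rw [← Real.exp_add, ← hv2]
    refine Real.exp_le_exp.2 ?_
    rcases le_or_gt v₀ v with hvv | hvv
    · -- `v ≥ c'/Cε`: `Cε v³ ≥ c' v²`
      have h1 : c' * v ^ 2 ≤ Cε * v ^ 3 := by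
        have : c' ≤ Cε * v := by
          rw [hv₀, div_le_iff₀ hCε] at hvv; linarith
        nlinarith
      have : 0 ≤ c' * v₀ ^ 2 := by positivity
      linarith
    · -- `v < c'/Cε`: `c' v² < c' v₀²`
      have h1 : c' * v ^ 2 ≤ c' * v₀ ^ 2 := by
        refine mul_le_mul_of_nonneg_left ?_ hc'.le
        exact pow_le_pow_left₀ hv0 hvv.le 2
      have h2 : 0 ≤ (1 - β) * L := by
        have : 0 ≤ Cε * v ^ 3 := by positivity
        linarith
      linarith
  calc x * Real.exp (-((1 - β) * L))
      ≤ x * (Real.exp (c' * v₀ ^ 2) * Real.exp (-(c' * Real.sqrt L))) :=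
        mul_le_mul_of_nonneg_left hstep hx0.le
    _ = Real.exp (c' * v₀ ^ 2) * x * Real.exp (-(c' * Real.sqrt L)) := by ring

/-- **The core estimate for `Re(w M(x, χ))`** (Montgomery–Vaughan §11.3, Exercises 7–8, via the
Riesz-mean engine `ExcPsiData.exists_psi_bound` applied to `1 + λ Re(wχ(n))μ(n)` and Siegel's
theorem for the exceptional term): there are absolute `c' > 0`, `K, D ≥ 0` such that for every
`A > 0` there is `K_A` with, for all `q ≥ 1`, all characters `χ` mod `q`, all `|w| ≤ 1` and all
`x ≥ 64` with `log q ≤ √log x` and `q ≤ (log x)^A`: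
`|Re(w ∑_{n ≤ x} χ(n)μ(n))| ≤ (K log 4q + 1)((D q² + K_A) x e^{−c'√log x} + 1)`.
[cite: MontgomeryVaughan2007, §11.3 Exercise 8] -/
theorem exists_core_bound :
    ∃ c' : ℝ, 0 < c' ∧ c' ≤ 1 ∧ ∃ K : ℝ, 0 ≤ K ∧ ∃ D : ℝ, 0 ≤ D ∧ ∀ A : ℝ, 0 < A → ∃ KA : ℝ, 0 ≤ KA ∧
      ∀ (q : ℕ) [NeZero q] (χ : DirichletCharacter ℂ q) (w : ℂ), ‖w‖ ≤ 1 →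
        ∀ x : ℝ, 64 ≤ x → Real.log q ≤ Real.sqrt (Real.log x) → (q : ℝ) ≤ Real.log x ^ A →
          |(w * ∑ n ∈ Finset.Ioc 0 ⌊x⌋₊, χ (n : ZMod q) * (μ n : ℂ)).re| ≤
            (K * (Real.log q + Real.log 4) + 1) *
              ((D * (q : ℝ) ^ 2 + KA) * x * Real.exp (-(c' * Real.sqrt (Real.log x))) + 1) := by
  obtain ⟨c, hc, hc2, K, hK, C₀, hC₀, hdata⟩ := exists_excPsiData_all
  obtain ⟨A₀, hA₀, hpsi⟩ := ExcPsiData.exists_psi_bound hc hc2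
  refine ⟨c / 80, by positivity, by linarith, K, hK, A₀ * (C₀ + 1), by positivity, fun A hA ↦ ?_⟩
  obtain ⟨KA, hKA1, hSieg⟩ := exists_rpow_excZero_le (c' := c / 80) (by positivity) hA
  refine ⟨2 * KA, by linarith, fun q _ χ w hw x hx hlogq hqx ↦ ?_⟩
  obtain ⟨β, α, F, hcase, hD⟩ := hdata q χ w hw
  have hb := hpsi hD x hx hlogq
  rw [psi_coeff_eq] at hb
  set lam : ℝ := 1 / (K * (Real.log q + Real.log 4) + 1) with hlam
  set S : ℂ := ∑ n ∈ Finset.Ioc 0 ⌊x⌋₊, χ (n : ZMod q) * (μ n : ℂ) with hSdef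
  set E : ℝ := Real.exp (-(c / 80 * Real.sqrt (Real.log x))) with hEdef
  have hx0 : 0 < x := by linarith
  have hq1 : (1 : ℝ) ≤ q := by exact_mod_cast NeZero.one_le
  have hℒ₀ : 1 ≤ Real.log q + Real.log 4 := PagePNT.one_le_ell0 q
  have hden : 0 < K * (Real.log q + Real.log 4) + 1 := by positivity
  have hlam0 : 0 < lam := by rw [hlam]; positivity
  -- `|⌊x⌋ − x| ≤ 1`
  have hfloor : |(⌊x⌋₊ : ℝ) - x| ≤ 1 := by
    rw [abs_sub_comm, abs_of_nonneg (sub_nonneg.2 (Nat.floor_le hx0.le))]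
    exact (sub_lt_iff_lt_add.2 (by linarith [Nat.lt_floor_add_one x])).le
  -- the exceptional term `|α| x^β/β ≤ 2 x^β ≤ 2 K_A x E` (or `0`)
  have hexc : |α * x ^ β / β| ≤ 2 * KA * x * E := by
    rcases hcase with hα0 | ⟨hχ1, hχ2, hβ⟩
    · rw [hα0, zero_mul, zero_div, abs_zero]; positivity
    · have hβhalf := hD.β_ge
      have hβpos : 0 < β := by linarith
      have hxβ : 0 < x ^ β := Real.rpow_pos_of_pos hx0 β
      have hS := hSieg q χ hχ2 hχ1 β hβ x hx hqx
      rw [abs_div, abs_mul, abs_of_pos hβpos, abs_of_pos hxβ, div_le_iff₀ hβpos]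
      calc |α| * x ^ β ≤ 1 * (KA * x * E) := mul_le_mul hD.α_le hS hxβ.le zero_le_one
        _ ≤ 2 * KA * x * E * β := by
            rw [one_mul]
            have : 0 ≤ KA * x * E := by
              have : 0 ≤ KA := by linarith
              positivity
            nlinarith
  -- `λ |Re(wS)| ≤ main + 1 + exceptional`
  have hkey : lam * |(w * S).re| ≤ A₀ * (C₀ * (q : ℝ) ^ 2 + 1) * x * E + 1 + 2 * KA * x * E := by
    have heq : lam * (w * S).re = ((⌊x⌋₊ : ℝ) + lam * (w * S).re - (x - α * x ^ β / β)) +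
        (x - (⌊x⌋₊ : ℝ)) - α * x ^ β / β := by ring
    rw [← abs_of_pos hlam0, ← abs_mul, heq]
    calc |((⌊x⌋₊ : ℝ) + lam * (w * S).re - (x - α * x ^ β / β)) + (x - (⌊x⌋₊ : ℝ)) - α * x ^ β / β|
        ≤ |((⌊x⌋₊ : ℝ) + lam * (w * S).re - (x - α * x ^ β / β)) + (x - (⌊x⌋₊ : ℝ))| +
            |α * x ^ β / β| := abs_sub _ _
      _ ≤ (|(⌊x⌋₊ : ℝ) + lam * (w * S).re - (x - α * x ^ β / β)| + |x - (⌊x⌋₊ : ℝ)|) +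
            |α * x ^ β / β| := add_le_add (abs_add_le _ _) le_rfl
      _ ≤ (A₀ * (C₀ * (q : ℝ) ^ 2 + 1) * x * E + 1) + 2 * KA * x * E := by
          refine add_le_add (add_le_add hb ?_) hexc
          rw [abs_sub_comm]; exact hfloor
      _ = _ := by ring
  -- divide by `λ` and simplify the constants
  have hq2 : (1 : ℝ) ≤ (q : ℝ) ^ 2 := one_le_pow₀ hq1
  have hmono : A₀ * (C₀ * (q : ℝ) ^ 2 + 1) ≤ A₀ * (C₀ + 1) * (q : ℝ) ^ 2 := by
    have : A₀ * (C₀ + 1) * (q : ℝ) ^ 2 = A₀ * (C₀ * (q : ℝ) ^ 2 + (q : ℝ) ^ 2) := by ring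
    rw [this]
    exact mul_le_mul_of_nonneg_left (by linarith) hA₀.le
  have hxE : 0 ≤ x * E := by positivity
  calc |(w * S).re| = (K * (Real.log q + Real.log 4) + 1) * (lam * |(w * S).re|) := by
        rw [hlam]; field_simp
    _ ≤ (K * (Real.log q + Real.log 4) + 1) *
          (A₀ * (C₀ * (q : ℝ) ^ 2 + 1) * x * E + 1 + 2 * KA * x * E) :=
        mul_le_mul_of_nonneg_left hkey hden.le
    _ ≤ (K * (Real.log q + Real.log 4) + 1) *
          ((A₀ * (C₀ + 1) * (q : ℝ) ^ 2 + 2 * KA) * x * E + 1) := by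
        refine mul_le_mul_of_nonneg_left ?_ hden.le
        have := mul_le_mul_of_nonneg_right hmono hxE
        nlinarith

/-! ## Elementary inequalities for the final assembly -/

/-- `L^k exp(−a√L) ≤ (2k)!/a^{2k}` for `L ≥ 0`, `a > 0` (Taylor lower bound for `exp`).
[folklore] -/
theorem pow_mul_exp_neg_sqrt_le {a L : ℝ} (ha : 0 < a) (hL : 0 ≤ L) (k : ℕ) :
    L ^ k * Real.exp (-(a * Real.sqrt L)) ≤ (2 * k).factorial / a ^ (2 * k) := by
  have h := pow_mul_pow_div_factorial_le_exp_sqrt ha.le hL k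
  rw [div_le_iff₀ (by positivity)] at h
  rw [Real.exp_neg, le_div_iff₀ (by positivity)]
  have hE := Real.exp_pos (a * Real.sqrt L)
  calc L ^ k * (Real.exp (a * Real.sqrt L))⁻¹ * a ^ (2 * k)
      = (a ^ (2 * k) * L ^ k) / Real.exp (a * Real.sqrt L) := by field_simp
    _ ≤ (2 * k).factorial := by rw [div_le_iff₀ hE]; linarith

/-- `√L ≤ x exp(−a√L)` for `x > 0`, `L = log x ≥ 1`, `a ≤ 1`:
`x e^{−a√L} = e^{L − a√L} ≥ e^{L − √L} ≥ 1 + L − √L ≥ √L`. [folklore] -/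
theorem sqrt_log_le_mul_exp {x a : ℝ} (hx0 : 0 < x) (hx : 1 ≤ Real.log x) (ha1 : a ≤ 1) :
    Real.sqrt (Real.log x) ≤ x * Real.exp (-(a * Real.sqrt (Real.log x))) := by
  set L := Real.log x with hL
  have hL0 : 0 ≤ L := by linarith
  have hs1 : 1 ≤ Real.sqrt L := Real.one_le_sqrt.2 hx
  have hsL : Real.sqrt L ≤ L := by
    have h := Real.sq_sqrt hL0
    nlinarith
  have hsq : Real.sqrt L ≤ 1 + (L - Real.sqrt L) := by
    have h := Real.sq_sqrt hL0
    nlinarith [sq_nonneg (Real.sqrt L - 1)]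
  calc Real.sqrt L ≤ 1 + (L - Real.sqrt L) := hsq
    _ ≤ (L - Real.sqrt L) + 1 := by ring_nf; rfl
    _ ≤ Real.exp (L - Real.sqrt L) := Real.add_one_le_exp _
    _ ≤ Real.exp (L - a * Real.sqrt L) := Real.exp_le_exp.2 (by nlinarith)
    _ = x * Real.exp (-(a * Real.sqrt L)) := by
        rw [sub_eq_add_neg, Real.exp_add, hL, Real.exp_log hx0]

/-- `log L ≤ 4 L^{1/4}` in the form: for `L ≥ 1`, `log L ≤ 4 √(√L)`. [folklore] -/
theorem log_le_four_mul_sqrt_sqrt {L : ℝ} (hL : 1 ≤ L) :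
    Real.log L ≤ 4 * Real.sqrt (Real.sqrt L) := by
  set v := Real.sqrt (Real.sqrt L) with hv
  have hL0 : 0 < L := by linarith
  have hv1 : 1 ≤ v := Real.one_le_sqrt.2 (Real.one_le_sqrt.2 hL)
  have hv0 : 0 < v := by linarith
  have hv4 : v ^ 4 = L := by
    rw [show (4 : ℕ) = 2 * 2 by norm_num, pow_mul, hv, Real.sq_sqrt (Real.sqrt_nonneg L),
      Real.sq_sqrt hL0.le]
  calc Real.log L = Real.log (v ^ 4) := by rw [hv4]
    _ = 4 * Real.log v := by rw [Real.log_pow]; norm_num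
    _ ≤ 4 * (v - 1) := by linarith [Real.log_le_sub_one_of_pos hv0]
    _ ≤ 4 * v := by linarith

/-- `exp 5 ≥ 64`. [folklore] -/
theorem sixtyfour_le_exp_five : (64 : ℝ) ≤ Real.exp 5 := by
  have h1 := Real.exp_one_gt_d9
  have h5 : Real.exp 5 = Real.exp 1 ^ 5 := by rw [← Real.exp_nat_mul]; norm_num
  rw [h5]
  have h2 : (2.5 : ℝ) ≤ Real.exp 1 := by linarith
  calc (64 : ℝ) ≤ 2.5 ^ 5 := by norm_num
    _ ≤ Real.exp 1 ^ 5 := pow_le_pow_left₀ (by norm_num) h2 5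

end MoebiusTwist

/-! ## MV §11.3 Exercise 8: `M(x, χ) ≪_A x exp(−c₁√log x)` for `q ≤ (log x)^A` -/

open MoebiusTwist in
set_option maxHeartbeats 1600000 in
/-- **Montgomery–Vaughan §11.3 Exercise 8 (the Möbius statement), PROVED**: the named fact
`Literature.NumberTheory.LFunctions.MoebiusCharacterSumBound` holds — there is an absolute
`c₁ > 0` such that for every `A > 0` there is `C` with `‖∑_{n ≤ x} μ(n)χ(n)‖ ≤ C x exp(−c₁√log x)`
for all `x ≥ 2`, `1 ≤ q ≤ (log x)^A` and all Dirichlet characters `χ` mod `q`. Proof (MV Ex. 7–8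
with Theorem 11.16 and Corollary 11.18): Landau's method with an exceptional zero
(`ExcPsiData.exists_psi_bound`) for the non-negative sequences `1 + λRe(wχ(n))μ(n)`, `w = 1, −i`
(`MoebiusTwist.exists_core_bound`, with Siegel's theorem `Siegel.exists_one_sub_realZero_ge` for
the term `x^{β₁}`), valid for `log q ≤ √log x`, hence for `q ≤ (log x)^A` once
`log x ≥ (4A)⁴`; smaller `x` are trivial (`|M(x, χ)| ≤ x`); the powers of `log x` coming from
`q² ≤ (log x)^{2A}` and `1/λ ≍ log 4q` are absorbed by halving the constant in the exponent.
[cite: MontgomeryVaughan2007, §11.3 Exercise 8 p. 383] -/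
theorem MoebiusCharacterSumBound_holds : MoebiusCharacterSumBound := by
  obtain ⟨c', hc', hc'1, K, hK, D, hD, hcore⟩ := MoebiusTwist.exists_core_bound
  refine ⟨c' / 2, by positivity, fun A hA ↦ ?_⟩
  obtain ⟨KA, hKA, hb⟩ := hcore A hA
  -- constants
  set a : ℝ := c' / 2 with hadef
  have ha0 : 0 < a := by positivity
  have ha1 : a ≤ 1 := by rw [hadef]; linarith
  set k : ℕ := ⌈2 * A⌉₊ with hk
  have hAk : 2 * A ≤ k := Nat.le_ceil _
  set U : ℝ := max ((4 * A) ^ 4) 5 with hU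
  have hU5 : 5 ≤ U := le_max_right _ _
  have hUA : (4 * A) ^ 4 ≤ U := le_max_left _ _
  set M₁ : ℝ := (2 * (k + 1)).factorial / a ^ (2 * (k + 1)) with hM₁
  set M₂ : ℝ := (2 * 1).factorial / a ^ (2 * 1) with hM₂
  have hM₁0 : 0 ≤ M₁ := by positivity
  have hM₂0 : 0 ≤ M₂ := by positivity
  set Cbig : ℝ := 2 * (4 * K + 1) * (D * M₁ + KA * M₂ + 1) with hCbig
  have hCbig0 : 0 ≤ Cbig := by positivity
  set Csmall : ℝ := Real.exp (a * Real.sqrt U) with hCsmall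
  have hCsmall0 : 0 ≤ Csmall := (Real.exp_pos _).le
  refine ⟨Cbig + Csmall, fun x hx q hq hqx χ ↦ ?_⟩
  haveI : NeZero q := ⟨by omega⟩
  have hx0 : 0 < x := by linarith
  set L : ℝ := Real.log x with hL
  have hL0 : 0 < L := Real.log_pos (by linarith)
  set E : ℝ := Real.exp (-(a * Real.sqrt L)) with hEdef
  have hE0 : 0 < E := Real.exp_pos _
  have hgoalE : Real.exp (-(c' / 2) * Real.sqrt (Real.log x)) = E := by
    rw [hEdef, hadef, hL]; ring_nf
  rw [hgoalE]
  -- the sum, reindexed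
  set S : ℂ := ∑ n ∈ Finset.Ioc 0 ⌊x⌋₊, χ (n : ZMod q) * (μ n : ℂ) with hSdef
  have hsumS : ∑ n ∈ Finset.Icc 1 ⌊x⌋₊, (μ n : ℂ) * χ (n : ZMod q) = S := by
    have hIcc : Finset.Icc 1 ⌊x⌋₊ = Finset.Ioc 0 ⌊x⌋₊ := rfl
    rw [hIcc, hSdef]
    exact Finset.sum_congr rfl fun n _ ↦ mul_comm _ _
  rw [hsumS]
  -- the trivial bound `‖S‖ ≤ x`
  have htriv : ‖S‖ ≤ x := by
    calc ‖S‖ ≤ ∑ n ∈ Finset.Ioc 0 ⌊x⌋₊, ‖χ (n : ZMod q) * (μ n : ℂ)‖ := norm_sum_le _ _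
      _ ≤ ∑ n ∈ Finset.Ioc 0 ⌊x⌋₊, (1 : ℝ) := by
          refine Finset.sum_le_sum fun n _ ↦ ?_
          rw [norm_mul, Complex.norm_intCast]
          calc ‖χ (n : ZMod q)‖ * |(μ n : ℝ)| ≤ 1 * 1 := by
                gcongr
                · exact DirichletCharacter.norm_le_one χ _
                · exact_mod_cast ArithmeticFunction.abs_moebius_le_one
            _ = 1 := one_mul _
      _ = ⌊x⌋₊ := by rw [Finset.sum_const, Nat.card_Ioc, nsmul_eq_mul, mul_one, Nat.sub_zero]
      _ ≤ x := Nat.floor_le hx0.le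
  rcases lt_or_ge L U with hLU | hLU
  · -- small `x`: `‖S‖ ≤ x ≤ Csmall x E`
    have h1 : 1 ≤ Csmall * E := by
      rw [hCsmall, hEdef, ← Real.exp_add]
      refine Real.one_le_exp ?_
      have : Real.sqrt L ≤ Real.sqrt U := Real.sqrt_le_sqrt hLU.le
      nlinarith
    calc ‖S‖ ≤ x := htriv
      _ ≤ x * (Csmall * E) := le_mul_of_one_le_right hx0.le h1
      _ = Csmall * x * E := by ring
      _ ≤ (Cbig + Csmall) * x * E := by
          have : 0 ≤ Cbig * x * E := by positivity
          nlinarith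
  · -- large `x`
    have hL5 : 5 ≤ L := hU5.trans hLU
    have hL1 : 1 ≤ L := by linarith
    have hx64 : 64 ≤ x := by
      calc (64 : ℝ) ≤ Real.exp 5 := sixtyfour_le_exp_five
        _ ≤ Real.exp L := Real.exp_le_exp.2 hL5
        _ = x := by rw [hL, Real.exp_log hx0]
    -- `v = L^{1/4} ≥ 4A`, `log q ≤ A log L ≤ 4A v ≤ v² = √L`
    set v : ℝ := Real.sqrt (Real.sqrt L) with hv
    have hv2 : v ^ 2 = Real.sqrt L := Real.sq_sqrt (Real.sqrt_nonneg L)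
    have hv1 : 1 ≤ v := Real.one_le_sqrt.2 (Real.one_le_sqrt.2 hL1)
    have hvA : 4 * A ≤ v := by
      have h1 : Real.sqrt (Real.sqrt ((4 * A) ^ 4)) ≤ v :=
        Real.sqrt_le_sqrt (Real.sqrt_le_sqrt (hUA.trans hLU))
      have h2 : Real.sqrt (Real.sqrt ((4 * A) ^ 4)) = 4 * A := by
        rw [show (4 * A) ^ 4 = ((4 * A) ^ 2) ^ 2 by ring, Real.sqrt_sq (by positivity),
          Real.sqrt_sq (by positivity)]
      rwa [h2] at h1
    have hq1 : (1 : ℝ) ≤ q := by exact_mod_cast hq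
    have hq0 : (0 : ℝ) < q := by linarith
    have hlogq : Real.log q ≤ Real.sqrt L := by
      have h1 : Real.log q ≤ A * Real.log L := by
        calc Real.log q ≤ Real.log (L ^ A) := Real.log_le_log hq0 hqx
          _ = A * Real.log L := Real.log_rpow hL0 A
      have h2 : A * Real.log L ≤ 4 * A * v :=
        calc A * Real.log L ≤ A * (4 * v) :=
              mul_le_mul_of_nonneg_left (log_le_four_mul_sqrt_sqrt hL1) hA.le
          _ = 4 * A * v := by ring
      have h3 : 4 * A * v ≤ v ^ 2 := by nlinarith
      linarith
    have hlogq0 : 0 ≤ Real.log q := Real.log_nonneg hq1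
    -- the core bound for `w = 1` and `w = −i`
    have hB1 := hb q χ 1 (by simp) x hx64 hlogq hqx
    have hB2 := hb q χ (-I) (by simp) x hx64 hlogq hqx
    rw [one_mul] at hB1
    have hre2 : (-I * S).re = S.im := by simp
    rw [hre2] at hB2
    set E' : ℝ := Real.exp (-(c' * Real.sqrt (Real.log x))) with hE'
    set B : ℝ := (K * (Real.log q + Real.log 4) + 1) * ((D * (q : ℝ) ^ 2 + KA) * x * E' + 1)
      with hBdef
    have hnormS : ‖S‖ ≤ 2 * B := by
      calc ‖S‖ ≤ |S.re| + |S.im| := Complex.norm_le_abs_re_add_abs_im S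
        _ ≤ B + B := add_le_add hB1 hB2
        _ = 2 * B := by ring
    -- sizes: `K log 4q + 1 ≤ (4K + 1) √L`, `q² ≤ L^k`, `E' = E · E`
    have hsqrt1 : 1 ≤ Real.sqrt L := Real.one_le_sqrt.2 hL1
    have hlog4 : Real.log 4 ≤ 3 := by
      have := Real.log_le_sub_one_of_pos (by norm_num : (0 : ℝ) < 4); linarith
    have hfac1 : K * (Real.log q + Real.log 4) + 1 ≤ (4 * K + 1) * Real.sqrt L := by
      have : Real.log q + Real.log 4 ≤ 4 * Real.sqrt L := by linarith
      nlinarith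
    have hqk : (q : ℝ) ^ 2 ≤ L ^ k := by
      calc (q : ℝ) ^ 2 ≤ (L ^ A) ^ 2 := pow_le_pow_left₀ hq0.le hqx 2
        _ = L ^ (2 * A) := by
            rw [← Real.rpow_natCast, ← Real.rpow_mul hL0.le]; norm_num; ring_nf
        _ ≤ L ^ (k : ℝ) := Real.rpow_le_rpow_of_exponent_le hL1 hAk
        _ = L ^ k := Real.rpow_natCast L k
    have hEE : E' = E * E := by rw [hE', hEdef, ← Real.exp_add, hadef, hL]; ring_nf
    -- the three pieces
    have hp1 : Real.sqrt L * L ^ k * E ≤ M₁ := by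
      calc Real.sqrt L * L ^ k * E ≤ L * L ^ k * E := by
            refine mul_le_mul_of_nonneg_right (mul_le_mul_of_nonneg_right ?_ (by positivity)) hE0.le
            have h := Real.sq_sqrt hL0.le
            nlinarith
        _ = L ^ (k + 1) * E := by ring
        _ ≤ M₁ := pow_mul_exp_neg_sqrt_le ha0 hL0.le (k + 1)
    have hp2 : Real.sqrt L * E ≤ M₂ := by
      calc Real.sqrt L * E ≤ L * E := by
            refine mul_le_mul_of_nonneg_right ?_ hE0.le
            have h := Real.sq_sqrt hL0.le
            nlinarith
        _ = L ^ 1 * E := by ring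
        _ ≤ M₂ := pow_mul_exp_neg_sqrt_le ha0 hL0.le 1
    have hp3 : Real.sqrt L ≤ x * E := sqrt_log_le_mul_exp hx0 hL1 ha1
    -- assemble
    have hxE : 0 ≤ x * E := by positivity
    have h2B : 2 * B ≤ Cbig * x * E := by
      have hstep1 : B ≤ (4 * K + 1) * Real.sqrt L * ((D * L ^ k + KA) * x * E' + 1) := by
        rw [hBdef]
        refine mul_le_mul hfac1 ?_ (by positivity) (by positivity)
        have : (D * (q : ℝ) ^ 2 + KA) * x * E' ≤ (D * L ^ k + KA) * x * E' := by
          refine mul_le_mul_of_nonneg_right (mul_le_mul_of_nonneg_right ?_ hx0.le) (Real.exp_pos _).le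
          nlinarith
        linarith
      have hstep2 : Real.sqrt L * ((D * L ^ k + KA) * x * E' + 1) ≤ (D * M₁ + KA * M₂ + 1) * (x * E) := by
        rw [hEE]
        have e : Real.sqrt L * ((D * L ^ k + KA) * x * (E * E) + 1) =
            D * (Real.sqrt L * L ^ k * E) * (x * E) + KA * (Real.sqrt L * E) * (x * E) + Real.sqrt L := by
          ring
        rw [e]
        have h1 : D * (Real.sqrt L * L ^ k * E) * (x * E) ≤ D * M₁ * (x * E) :=
          mul_le_mul_of_nonneg_right (mul_le_mul_of_nonneg_left hp1 hD) hxE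
        have h2 : KA * (Real.sqrt L * E) * (x * E) ≤ KA * M₂ * (x * E) :=
          mul_le_mul_of_nonneg_right (mul_le_mul_of_nonneg_left hp2 hKA) hxE
        nlinarith
      calc 2 * B ≤ 2 * ((4 * K + 1) * Real.sqrt L * ((D * L ^ k + KA) * x * E' + 1)) := by linarith
        _ = 2 * (4 * K + 1) * (Real.sqrt L * ((D * L ^ k + KA) * x * E' + 1)) := by ring
        _ ≤ 2 * (4 * K + 1) * ((D * M₁ + KA * M₂ + 1) * (x * E)) :=
            mul_le_mul_of_nonneg_left hstep2 (by positivity)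
        _ = Cbig * x * E := by rw [hCbig]; ring
    calc ‖S‖ ≤ 2 * B := hnormS
      _ ≤ Cbig * x * E := h2B
      _ ≤ (Cbig + Csmall) * x * E := by
          have : 0 ≤ Csmall * x * E := by positivity
          nlinarith


end Literature.NumberTheory.LFunctions
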